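import Summits.ABC.IUTFork.Conditional.WRowUnconditionalPackages
import Summits.ABC.IUTFork.Conditional.WRowUnconditionalCellsSlot
import HarnessLib

/-!
# R-W WINDOW-TABLE — the abc triple `7¹¹·19 + 5¹²·1019·7151² = 2²⁸·3¹²·11³·67` at EVERY prime level `l ≥ 1663`: packages — the prime divisors,
# the valuations, and the slot socket's arithmetic hypothesis `hcell` uniformly in `l` (the band theorem itself is `WRowFrey37569208117AllLevels`)

PROOF-ONLY file (D-0012; 0 definitions, 0 `Prop` facts, no instance) of the abc-iut cell — D-0079 RESCUE sub-cell R-W «WINDOW Θ-SIDE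
INEQUALITY», seat abc-iut-w5-d009 (gen 14), row «W:GAP-1019» part 2 (the band above the gap). abc-iut-W-num-5 g3's census (2026-08-27T02:47:45Z):
the complete Szpiro-bad admissible set of this triple is `{17, …, 127, 1019, 7151}`; `l ≤ 480` is REFUTED by abc-iut-w5-d107's [LIN]-uniform band
(`GenuineK.not_pilotKummerCompatHull_chosen_frey37569208117_band`), `l = 1019` SPLITS on the local type at `7` (this seat's `WRowFrey37569208117GapFifteen`
/ `…GapThirty`), and THIS file decides every prime `l ≥ 1663` on the INHABITED side, hypothesis-free, instantiating abc-iut-W-row-1's INTEGER-SLOT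
triple socket `WRow.licence_triple_unconditional_slot` (`Cor312LicenceTripleUnconditionalSlot`, p488934; pattern of abc-iut-W-row-2's
`WRowFrey73AllLevels` and abc-iut-W-row-1's `WRowReyssatSmallLevels`). TAKES NO SIDE on [IUTchIII] Cor. 3.12 (S. Mochizuki, *Inter-universal
Teichmüller theory III*, Cor. 3.12 p. 173–174; Step (xi-f) p. 184) or on any author; «inhabited as typed» ≠ «asserted in print».

THE ARITHMETIC (`hcell` of the slot socket, uniformly in `l`; per bad prime `p ≠ 2, l` the socket's divisibilities force `e = m_p·l·n`, `n ≥ 1`):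
`p = 3` (`v = 12`, `p ∣ c` even): `e = 10l·n` (`5l ∣ e` from `15l ∣ 12e`, `2 ∣ e`), TAME different (`3 ∣ v`), slot `⌊e/2⌋ = 5l·n`, `A = 5`;
`p = 5` (`v = 12`): `e = 20l·n`, WILD different `2e−1`, slot `⌊e/4⌋ = 5l·n`, `A = 4`; `p = 7` (`v = 11`): `e = 15l·n` (`l ≠ 11`), tame, slot
`⌊15l·n/6⌋ ≥ ((5l−1)/2)·n`, `A = 5` — THE THRESHOLD PRIME: the floor-free top-label cell is `−20L² + 16561L + 16565` in `L = (l−1)/2`, `≤ 0` iff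
`L ≥ 830`, i.e. `l ≥ 1661` (first prime `1663`; desk sweep work/allcheck.py of this seat: every prime `1663 ≤ l < 60000`, 0 violations; with the
volume witness `ρin = 1` instead of the slot the threshold would be `2213`); `p = 11` (`v = 3`, `p ∣ c` odd, twist `30l ∣ 3e`): `e = 10l·n`, slot
`l·n`, `A = 1`; `p = 19, 1019` (`v = 1`), `7151` (`v = 2`): `e = 15l·n`, `A = 0`; `p = 67` (`v = 1`, `p ∣ c` odd): `e = 30l·n`, `A = 0` (slot
unused, `r = 0`). `e` is off the cyclotomic indices by the auxiliary prime `5` (at `3, 7, 19, 67, 1019`), `3` (at `7151`), `l` (at `5, 11`).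

WHAT IS PROVED (namespace `Summit.ABC.IUTFork.Conditional`; pure arithmetic, consumed by `WRowFrey37569208117AllLevels`):
`WRow.eq_of_prime_dvd_frey37569208117` (the prime divisors of `abc`), `WRow.factorization_frey37569208117` (`v₃ = v₅ = 12`, `v₇ = 11`, `v₁₁ = 3`,
`v₁₉ = v₆₇ = v₁₀₁₉ = 1`, `v₇₁₅₁ = 2`), **`WRow.hcell_frey37569208117_all`** — the slot socket's `hcell` for this triple at EVERY prime `l ≥ 1663`, with
the exponents `A`/`B` displayed in its statement. HONEST SCOPE: integer arithmetic only; nothing here bears on the printed inequality; typed ≠ proved;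
no abc claim.
[cite: Mochizuki2012, IUTchI Def. 3.1 (b),(c) pp. 61–62, Rmk. 3.1.5 p. 65, Ex. 3.2 (iv) p. 71; IUTchIII Cor. 3.12 Step (xi-f) p. 184; IUTchIV Prop. 1.1 p. 9, Prop. 1.2 (i)(ii) p. 10, Prop. 1.4 (ii) p. 13, Cor. 2.2 (ii) proof (P5) p. 46]
[cite: DupuyHilado2025, §3.3, §3.4, §4.9, §4.12] [cite: NeukirchANT1999, Ch. II (5.5)–(5.7)] [cite: SilvermanAEC2009, Prop. III.1.7(b)] [claim: Mochizuki2012, status: disputed] for every IUT sentence.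
-/

noncomputable section

open Set Function Metric NumberField IsDedekindDomain

namespace Summit.ABC.IUTFork.Conditional

open Thm311 Thm311.Real Cor312 Cor312Vol Cor312Prov Literature.IUT.LogThetaLattice Literature.IUT.LogVolume
  Literature.IUT.HodgeTheaters Literature.IUT.LogVolume.Cor22
open Literature.NumberTheory.NumberFields Literature.NumberTheory.GaloisRepresentations.Ultrametric
open Literature.NumberTheory.DiophantineGeometry Literature.NumberTheory.DiophantineGeometry.GenEll

/-! ## §0. The triple's prime divisors and valuations -/

/-- The primes dividing `abc = (7¹¹·19)·(5¹²·1019·7151²)·(2²⁸·3¹²·11³·67)`. [folklore] -/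
theorem WRow.eq_of_prime_dvd_frey37569208117 {p : ℕ} (hp : p.Prime)
    (h : p ∣ 7 ^ 11 * 19 * (5 ^ 12 * 1019 * 7151 ^ 2) * (2 ^ 28 * 3 ^ 12 * 11 ^ 3 * 67)) :
    p = 2 ∨ p = 3 ∨ p = 5 ∨ p = 7 ∨ p = 11 ∨ p = 19 ∨ p = 67 ∨ p = 1019 ∨ p = 7151 := by
  have key : ∀ {q k : ℕ}, q.Prime → p ∣ q ^ k → p = q := fun hq hd => (Nat.prime_dvd_prime_iff_eq hp hq).1 (hp.dvd_of_dvd_pow hd)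
  have key1 : ∀ {q : ℕ}, q.Prime → p ∣ q → p = q := fun hq hd => (Nat.prime_dvd_prime_iff_eq hp hq).1 hd
  rcases (Nat.Prime.dvd_mul hp).1 h with h1 | h1
  · rcases (Nat.Prime.dvd_mul hp).1 h1 with h2 | h2
    · rcases (Nat.Prime.dvd_mul hp).1 h2 with h3 | h3
      · exact Or.inr (Or.inr (Or.inr (Or.inl (key (by norm_num) h3))))
      · exact Or.inr (Or.inr (Or.inr (Or.inr (Or.inr (Or.inl (key1 (by norm_num) h3))))))
    · rcases (Nat.Prime.dvd_mul hp).1 h2 with h3 | h3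
      · rcases (Nat.Prime.dvd_mul hp).1 h3 with h4 | h4
        · exact Or.inr (Or.inr (Or.inl (key (by norm_num) h4)))
        · exact Or.inr (Or.inr (Or.inr (Or.inr (Or.inr (Or.inr (Or.inr (Or.inl (key1 (by norm_num) h4))))))))
      · exact Or.inr (Or.inr (Or.inr (Or.inr (Or.inr (Or.inr (Or.inr (Or.inr (key (by norm_num) h3))))))))
  · rcases (Nat.Prime.dvd_mul hp).1 h1 with h2 | h2
    · rcases (Nat.Prime.dvd_mul hp).1 h2 with h3 | h3
      · rcases (Nat.Prime.dvd_mul hp).1 h3 with h4 | h4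
        · exact Or.inl (key Nat.prime_two h4)
        · exact Or.inr (Or.inl (key Nat.prime_three h4))
      · exact Or.inr (Or.inr (Or.inr (Or.inr (Or.inl (key (by norm_num) h3)))))
    · exact Or.inr (Or.inr (Or.inr (Or.inr (Or.inr (Or.inr (Or.inl (key1 (by norm_num) h2)))))))

/-- `v_p(n) = k` from `n = p^k·m` with `p ∤ m`. [folklore] -/
private theorem factorization_eq_of_eq_pow_mul₉ {p k m n : ℕ} (hp : p.Prime) (hn : n = p ^ k * m) (hm : ¬ p ∣ m) :
    n.factorization p = k := by
  subst hn
  have hm0 : m ≠ 0 := fun h => hm (h ▸ dvd_zero p)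
  rw [Nat.factorization_mul (pow_ne_zero _ hp.ne_zero) hm0, Finsupp.add_apply, hp.factorization_pow, Finsupp.single_eq_same,
    Nat.factorization_eq_zero_of_not_dvd hm, add_zero]

/-- `v₃ = 12`, `v₅ = 12`, `v₇ = 11`, `v₁₁ = 3`, `v₁₉ = 1`, `v₆₇ = 1`, `v₁₀₁₉ = 1`, `v₇₁₅₁ = 2` for `abc = (7¹¹·19)·(5¹²·1019·7151²)·(2²⁸·3¹²·11³·67)`. [folklore] -/
theorem WRow.factorization_frey37569208117 :
    (7 ^ 11 * 19 * (5 ^ 12 * 1019 * 7151 ^ 2) * (2 ^ 28 * 3 ^ 12 * 11 ^ 3 * 67)).factorization 3 = 12 ∧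
    (7 ^ 11 * 19 * (5 ^ 12 * 1019 * 7151 ^ 2) * (2 ^ 28 * 3 ^ 12 * 11 ^ 3 * 67)).factorization 5 = 12 ∧
    (7 ^ 11 * 19 * (5 ^ 12 * 1019 * 7151 ^ 2) * (2 ^ 28 * 3 ^ 12 * 11 ^ 3 * 67)).factorization 7 = 11 ∧
    (7 ^ 11 * 19 * (5 ^ 12 * 1019 * 7151 ^ 2) * (2 ^ 28 * 3 ^ 12 * 11 ^ 3 * 67)).factorization 11 = 3 ∧
    (7 ^ 11 * 19 * (5 ^ 12 * 1019 * 7151 ^ 2) * (2 ^ 28 * 3 ^ 12 * 11 ^ 3 * 67)).factorization 19 = 1 ∧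
    (7 ^ 11 * 19 * (5 ^ 12 * 1019 * 7151 ^ 2) * (2 ^ 28 * 3 ^ 12 * 11 ^ 3 * 67)).factorization 67 = 1 ∧
    (7 ^ 11 * 19 * (5 ^ 12 * 1019 * 7151 ^ 2) * (2 ^ 28 * 3 ^ 12 * 11 ^ 3 * 67)).factorization 1019 = 1 ∧
    (7 ^ 11 * 19 * (5 ^ 12 * 1019 * 7151 ^ 2) * (2 ^ 28 * 3 ^ 12 * 11 ^ 3 * 67)).factorization 7151 = 2 :=
  ⟨factorization_eq_of_eq_pow_mul₉ (m := 11441226148466816914442569056256000000000000) Nat.prime_three (by norm_num) (by norm_num),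
    factorization_eq_of_eq_pow_mul₉ (m := 24905058982163880541504607608118251094016) (by norm_num) (by norm_num) (by norm_num),
    factorization_eq_of_eq_pow_mul₉ (m := 3075028791823382347197775872000000000000) (by norm_num) (by norm_num) (by norm_num),
    factorization_eq_of_eq_pow_mul₉ (m := 4568246931305299510013729032175616000000000000) (by norm_num) (by norm_num) (by norm_num),
    factorization_eq_of_eq_pow_mul₉ (m := 320017719240387034096224912727670784000000000000) (by norm_num) (by norm_num) (by norm_num),
    factorization_eq_of_eq_pow_mul₉ (m := 90751293515930651460123482713817088000000000000) (by norm_num) (by norm_num) (by norm_num),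
    factorization_eq_of_eq_pow_mul₉ (m := 5966964343049414767250513583734784000000000000) (by norm_num) (by norm_num) (by norm_num),
    factorization_eq_of_eq_pow_mul₉ (m := 118903344492889839703275012096000000000000) (by norm_num) (by norm_num) (by norm_num)⟩

/-! ## §1. The arithmetic at a symbolic prime level `l ≥ 1663` (slot form) -/

/-- **The slot socket's arithmetic hypothesis `hcell` for `(7¹¹·19, 5¹²·1019·7151², 2²⁸·3¹²·11³·67)` at EVERY prime level `l ≥ 1663`.** Per prime of `abc`
other than `2, l`: the divisibilities the socket hands over force `e = m_p·l·n` (`n ≥ 1`), `e` is off the cyclotomic indices, and with the fixed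
exponents `A₃ = 5, A₅ = 4, A₇ = 5, A₁₁ = 1, A₁₉ = A₆₇ = A₁₀₁₉ = A₇₁₅₁ = 0` the two end-label floor-free cells are quadratics in `(l−1)/2` that are `≤ 0`
from `L = 830` on (threshold prime `7`); all labels and multiples by `WRow.cell_tameslot_of_ends` / `WRow.cell_wild_of_ends`. [folklore] -/
theorem WRow.hcell_frey37569208117_all {l : ℕ} (hl : l.Prime) (hl0 : 1663 ≤ l) :
    ∀ p : ℕ, p.Prime → p ∣ 7 ^ 11 * 19 * (5 ^ 12 * 1019 * 7151 ^ 2) * (2 ^ 28 * 3 ^ 12 * 11 ^ 3 * 67) → p ≠ 2 → p ≠ l → ∀ e : ℕ, 0 < e → l ∣ e →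
      15 * l ∣ e * (7 ^ 11 * 19 * (5 ^ 12 * 1019 * 7151 ^ 2) * (2 ^ 28 * 3 ^ 12 * 11 ^ 3 * 67)).factorization p → (p ∣ 30 → (p - 1) ∣ e) →
      (p ∣ 2 ^ 28 * 3 ^ 12 * 11 ^ 3 * 67 → Odd ((7 ^ 11 * 19 * (5 ^ 12 * 1019 * 7151 ^ 2) * (2 ^ 28 * 3 ^ 12 * 11 ^ 3 * 67)).factorization p) →
        30 * l ∣ e * (7 ^ 11 * 19 * (5 ^ 12 * 1019 * 7151 ^ 2) * (2 ^ 28 * 3 ^ 12 * 11 ^ 3 * 67)).factorization p) →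
      (∀ k : ℕ, (e : ℤ) ≠ (p : ℤ) ^ k * ((p : ℤ) - 1)) ∧
      ∀ i : ℕ, i < (l - 1) / 2 →
        (e : ℤ) * ((((i + 1 : ℕ) : ℤ) ^ 2 * ((e * (2 * (7 ^ 11 * 19 * (5 ^ 12 * 1019 * 7151 ^ 2) * (2 ^ 28 * 3 ^ 12 * 11 ^ 3 * 67)).factorization p) / (2 * l) : ℕ) : ℤ) -
            ((i + 1 : ℕ) : ℤ) * (((if p ∣ 30 ∧ ¬ p ∣ (7 ^ 11 * 19 * (5 ^ 12 * 1019 * 7151 ^ 2) * (2 ^ 28 * 3 ^ 12 * 11 ^ 3 * 67)).factorization p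
              then 2 * e - 1 else e - 1 : ℕ) : ℕ) : ℤ) -
            ((i + 2 : ℕ) : ℤ) * ((((max 1 (e / (p - 1))) : ℕ) : ℤ))) / (e : ℤ)) +
          ((i + 2 : ℕ) : ℤ) * min ((p : ℤ) ^ (if p = 3 then 5 else if p = 5 then 4 else if p = 7 then 5 else if p = 11 then 1 else 0) -
              ((if p = 3 then 5 else if p = 5 then 4 else if p = 7 then 5 else if p = 11 then 1 else 0 : ℕ) : ℤ) * (e : ℤ))
            ((p : ℤ) ^ (if p = 3 then 6 else if p = 5 then 5 else if p = 7 then 6 else if p = 11 then 2 else 1) -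
              ((if p = 3 then 6 else if p = 5 then 5 else if p = 7 then 6 else if p = 11 then 2 else 1 : ℕ) : ℤ) * (e : ℤ)) ≤
        ((e * (2 * (7 ^ 11 * 19 * (5 ^ 12 * 1019 * 7151 ^ 2) * (2 ^ 28 * 3 ^ 12 * 11 ^ 3 * 67)).factorization p) / (2 * l) : ℕ) : ℤ) := by
  intro p hp hpabc h2 hpl e he hle h15 h30 hodd
  have hl2 : Nat.Coprime l 2 := (Nat.coprime_primes hl Nat.prime_two).mpr (by omega)
  rcases WRow.eq_of_prime_dvd_frey37569208117 hp hpabc with rfl | rfl | rfl | rfl | rfl | rfl | rfl | rfl | rfl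
  · exact absurd rfl h2
  · -- `p = 3`: `v = 12`, `e = 10·l·n`, tame different, slot `5l·n`, `A = 5`
    rw [WRow.factorization_frey37569208117.1] at h15 hodd ⊢
    have h5l : 5 * l ∣ e := by
      have h' : 5 * l * 3 ∣ e * 4 * 3 := by
        rw [show 5 * l * 3 = 15 * l by ring, show e * 4 * 3 = e * 12 by ring]; exact h15
      exact (Nat.Coprime.mul_left (by norm_num) (by simpa using hl2.pow_right 2) : Nat.Coprime (5 * l) 4).dvd_of_dvd_mul_right
        (Nat.dvd_of_mul_dvd_mul_right (by norm_num) h')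
    have hq : 2 ∣ e := by have := h30 (by norm_num); norm_num at this; exact this
    have he0 : 10 * l ∣ e := by
      have hc : Nat.Coprime 2 (5 * l) := Nat.Coprime.mul_right (by norm_num) hl2.symm
      have := Nat.Coprime.mul_dvd_of_dvd_of_dvd hc hq h5l; rwa [← mul_assoc, show (2 : ℕ) * 5 = 10 by norm_num] at this
    obtain ⟨n, rfl⟩ := he0
    have hn : 1 ≤ n := Nat.pos_of_ne_zero (by rintro rfl; simp at he)
    refine ⟨WRow.natCast_ne_pow_mul_sub_one (by norm_num : Nat.Prime 5) (by norm_num) (by norm_num) (by norm_num)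
      ⟨2 * l * n, by ring⟩, fun i hi => ?_⟩
    rw [if_neg (by norm_num : ¬ ((3 : ℕ) ∣ 30 ∧ ¬ (3 : ℕ) ∣ 12))]
    simp only [ite_true]
    refine WRow.cell_tameslot_of_ends ((3 : ℕ) : ℤ) (10 * l) (3 - 1) (5 * l) (2 * 12) (2 * l) 5 6 ((l - 1) / 2) 1 (by norm_num) (by norm_num)
      (by omega) (by omega) ⟨120, by ring⟩ (by omega) le_rfl ?_ hi hn
    have hP : 10 * l * (2 * 12) / (2 * l) = 120 := Nat.div_eq_of_eq_mul_left (by omega) (by ring)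
    have hpA : (((3 : ℕ) : ℤ)) ^ 5 = 243 := by norm_num
    rintro i (rfl | hi')
    · rw [hP, hpA]; push_cast; omega
    · obtain ⟨k, hk⟩ := hl.odd_of_ne_two (by omega)
      have hl' : l = 2 * i + 3 := by omega
      subst hl'
      have hi0 : ((829 : ℕ) : ℤ) ≤ (i : ℤ) := by exact_mod_cast (show 829 ≤ i by omega)
      rw [hP, hpA]; push_cast at hi0 ⊢
      nlinarith [sq_nonneg (i : ℤ), mul_nonneg (sub_nonneg.mpr hi0) (show (0 : ℤ) ≤ (i : ℤ) by positivity)]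
  · -- `p = 5`: `v = 12`, `e = 20·l·n`, WILD different, slot `5l·n`, `A = 4`
    rw [WRow.factorization_frey37569208117.2.1] at h15 hodd ⊢
    have h5l : 5 * l ∣ e := by
      have h' : 5 * l * 3 ∣ e * 4 * 3 := by
        rw [show 5 * l * 3 = 15 * l by ring, show e * 4 * 3 = e * 12 by ring]; exact h15
      exact (Nat.Coprime.mul_left (by norm_num) (by simpa using hl2.pow_right 2) : Nat.Coprime (5 * l) 4).dvd_of_dvd_mul_right
        (Nat.dvd_of_mul_dvd_mul_right (by norm_num) h')
    have hq : 4 ∣ e := by have := h30 (by norm_num); norm_num at this; exact this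
    have he0 : 20 * l ∣ e := by
      have hc : Nat.Coprime 4 (5 * l) := Nat.Coprime.mul_right (by norm_num) (by simpa using (hl2.pow_right 2).symm)
      have := Nat.Coprime.mul_dvd_of_dvd_of_dvd hc hq h5l; rwa [← mul_assoc, show (4 : ℕ) * 5 = 20 by norm_num] at this
    obtain ⟨n, rfl⟩ := he0
    have hn : 1 ≤ n := Nat.pos_of_ne_zero (by rintro rfl; simp at he)
    refine ⟨WRow.natCast_ne_pow_mul_sub_one hl (by norm_num) (by omega) (fun h => by have := Nat.le_of_dvd (by norm_num) h; omega)
      ⟨20 * n, by ring⟩, fun i hi => ?_⟩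
    rw [if_pos ⟨by norm_num, by norm_num⟩, max_eq_right (show 1 ≤ 20 * l * n / (5 - 1) by
      rw [Nat.le_div_iff_mul_le (by norm_num)]; nlinarith)]
    simp only [show ((5 : ℕ) = 3) = False from eq_false (by decide), ite_true, ite_false]
    refine WRow.cell_wild_of_ends ((5 : ℕ) : ℤ) (20 * l) (5 - 1) (2 * 12) (2 * l) 4 5 ((l - 1) / 2) (by norm_num) (by norm_num)
      (Dvd.intro (5 * l) (by ring)) (by omega) ⟨240, by ring⟩ (by omega) ?_ hi hn
    have hP : 20 * l * (2 * 12) / (2 * l) = 240 := Nat.div_eq_of_eq_mul_left (by omega) (by ring)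
    have hR : 20 * l / (5 - 1) = 5 * l := by omega
    have hpA : (((5 : ℕ) : ℤ)) ^ 4 = 625 := by norm_num
    rintro i (rfl | hi')
    · rw [hP, hR, hpA]; push_cast; omega
    · obtain ⟨k, hk⟩ := hl.odd_of_ne_two (by omega)
      have hl' : l = 2 * i + 3 := by omega
      subst hl'
      have hi0 : ((829 : ℕ) : ℤ) ≤ (i : ℤ) := by exact_mod_cast (show 829 ≤ i by omega)
      rw [hP, hR, hpA]; push_cast at hi0 ⊢
      nlinarith [sq_nonneg (i : ℤ), mul_nonneg (sub_nonneg.mpr hi0) (show (0 : ℤ) ≤ (i : ℤ) by positivity)]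
  · -- `p = 7`: `v = 11`, `e = 15·l·n` (`l ≠ 11`), tame, slot `⌊15l·n/6⌋ ≥ ((5l−1)/2)·n`, `A = 5` — the threshold prime
    rw [WRow.factorization_frey37569208117.2.2.1] at h15 hodd ⊢
    have hcop : Nat.Coprime (15 * l) 11 :=
      Nat.Coprime.mul_left (by norm_num) ((Nat.coprime_primes hl (by norm_num)).mpr (by omega))
    have he0 : 15 * l ∣ e := hcop.dvd_of_dvd_mul_right h15
    obtain ⟨n, rfl⟩ := he0
    have hn : 1 ≤ n := Nat.pos_of_ne_zero (by rintro rfl; simp at he)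
    refine ⟨WRow.natCast_ne_pow_mul_sub_one (by norm_num : Nat.Prime 5) (by norm_num) (by norm_num) (by norm_num)
      ⟨3 * l * n, by ring⟩, fun i hi => ?_⟩
    rw [if_neg (by norm_num : ¬ ((7 : ℕ) ∣ 30 ∧ ¬ (7 : ℕ) ∣ 11))]
    simp only [show ((7 : ℕ) = 3) = False from eq_false (by decide), show ((7 : ℕ) = 5) = False from eq_false (by decide), ite_true, ite_false]
    obtain ⟨k, hk⟩ := hl.odd_of_ne_two (by omega)
    refine WRow.cell_tameslot_of_ends ((7 : ℕ) : ℤ) (15 * l) (7 - 1) (5 * k + 2) (2 * 11) (2 * l) 5 6 ((l - 1) / 2) 1 (by norm_num) (by norm_num)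
      (by omega) (by omega) ⟨165, by ring⟩ (by omega) le_rfl ?_ hi hn
    have hP : 15 * l * (2 * 11) / (2 * l) = 165 := Nat.div_eq_of_eq_mul_left (by omega) (by ring)
    have hpA : (((7 : ℕ) : ℤ)) ^ 5 = 16807 := by norm_num
    rintro i (rfl | hi')
    · rw [hP, hpA]; push_cast; omega
    · have hl' : l = 2 * i + 3 := by omega
      subst hl'
      have hk' : k = i + 1 := by omega
      subst hk'
      have hi0 : ((829 : ℕ) : ℤ) ≤ (i : ℤ) := by exact_mod_cast (show 829 ≤ i by omega)
      rw [hP, hpA]; push_cast at hi0 ⊢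
      nlinarith [sq_nonneg (i : ℤ), mul_nonneg (sub_nonneg.mpr hi0) (show (0 : ℤ) ≤ (i : ℤ) by positivity)]
  · -- `p = 11`: `v = 3`, `p ∣ c` odd (twist `30l ∣ 3e`): `e = 10·l·n`, tame, slot `l·n`, `A = 1`
    rw [WRow.factorization_frey37569208117.2.2.2.1] at h15 hodd ⊢
    have hT : 10 * l ∣ e := by
      have h := hodd (by norm_num) (by decide)
      rw [show 30 * l = 10 * l * 3 by ring] at h
      exact Nat.dvd_of_mul_dvd_mul_right (by norm_num) h
    obtain ⟨n, rfl⟩ := hT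
    have hn : 1 ≤ n := Nat.pos_of_ne_zero (by rintro rfl; simp at he)
    refine ⟨WRow.natCast_ne_pow_mul_sub_one hl (by norm_num) (by omega) (fun h => by have := Nat.le_of_dvd (by norm_num) h; omega)
      ⟨10 * n, by ring⟩, fun i hi => ?_⟩
    rw [if_neg (by norm_num : ¬ ((11 : ℕ) ∣ 30 ∧ ¬ (11 : ℕ) ∣ 3))]
    simp only [show ((11 : ℕ) = 3) = False from eq_false (by decide), show ((11 : ℕ) = 5) = False from eq_false (by decide),
      show ((11 : ℕ) = 7) = False from eq_false (by decide), ite_true, ite_false]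
    refine WRow.cell_tameslot_of_ends ((11 : ℕ) : ℤ) (10 * l) (11 - 1) l (2 * 3) (2 * l) 1 2 ((l - 1) / 2) 1 (by norm_num) (by norm_num)
      (by omega) (by omega) ⟨30, by ring⟩ (by omega) le_rfl ?_ hi hn
    have hP : 10 * l * (2 * 3) / (2 * l) = 30 := Nat.div_eq_of_eq_mul_left (by omega) (by ring)
    have hpA : (((11 : ℕ) : ℤ)) ^ 1 = 11 := by norm_num
    rintro i (rfl | hi')
    · rw [hP, hpA]; push_cast; omega
    · obtain ⟨k, hk⟩ := hl.odd_of_ne_two (by omega)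
      have hl' : l = 2 * i + 3 := by omega
      subst hl'
      have hi0 : ((829 : ℕ) : ℤ) ≤ (i : ℤ) := by exact_mod_cast (show 829 ≤ i by omega)
      rw [hP, hpA]; push_cast at hi0 ⊢
      nlinarith [sq_nonneg (i : ℤ), mul_nonneg (sub_nonneg.mpr hi0) (show (0 : ℤ) ≤ (i : ℤ) by positivity)]
  · -- `p = 19`: `v = 1`, `e = 15·l·n`, `A = 0`
    rw [WRow.factorization_frey37569208117.2.2.2.2.1] at h15 hodd ⊢
    have he0 : 15 * l ∣ e := by simpa using h15
    obtain ⟨n, rfl⟩ := he0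
    have hn : 1 ≤ n := Nat.pos_of_ne_zero (by rintro rfl; simp at he)
    refine ⟨WRow.natCast_ne_pow_mul_sub_one (by norm_num : Nat.Prime 5) (by norm_num) (by norm_num) (by norm_num)
      ⟨3 * l * n, by ring⟩, fun i hi => ?_⟩
    rw [if_neg (by norm_num : ¬ ((19 : ℕ) ∣ 30 ∧ ¬ (19 : ℕ) ∣ 1))]
    simp only [show ((19 : ℕ) = 3) = False from eq_false (by decide), show ((19 : ℕ) = 5) = False from eq_false (by decide),
      show ((19 : ℕ) = 7) = False from eq_false (by decide), show ((19 : ℕ) = 11) = False from eq_false (by decide), ite_false]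
    refine WRow.cell_tameslot_of_ends ((19 : ℕ) : ℤ) (15 * l) (19 - 1) 0 (2 * 1) (2 * l) 0 1 ((l - 1) / 2) 1 (by norm_num) (by norm_num)
      (by omega) (by omega) ⟨15, by ring⟩ (by omega) le_rfl ?_ hi hn
    have hP : 15 * l * (2 * 1) / (2 * l) = 15 := Nat.div_eq_of_eq_mul_left (by omega) (by ring)
    have hpA : (((19 : ℕ) : ℤ)) ^ 0 = 1 := by norm_num
    rintro i (rfl | hi')
    · rw [hP, hpA]; push_cast; omega
    · obtain ⟨k, hk⟩ := hl.odd_of_ne_two (by omega)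
      have hl' : l = 2 * i + 3 := by omega
      subst hl'
      have hi0 : ((829 : ℕ) : ℤ) ≤ (i : ℤ) := by exact_mod_cast (show 829 ≤ i by omega)
      rw [hP, hpA]; push_cast at hi0 ⊢
      nlinarith [sq_nonneg (i : ℤ), mul_nonneg (sub_nonneg.mpr hi0) (show (0 : ℤ) ≤ (i : ℤ) by positivity)]
  · -- `p = 67`: `v = 1`, `p ∣ c` odd (twist): `e = 30·l·n`, `A = 0`
    rw [WRow.factorization_frey37569208117.2.2.2.2.2.1] at h15 hodd ⊢
    have hT : 30 * l ∣ e := by simpa using hodd (by norm_num) (by decide)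
    obtain ⟨n, rfl⟩ := hT
    have hn : 1 ≤ n := Nat.pos_of_ne_zero (by rintro rfl; simp at he)
    refine ⟨WRow.natCast_ne_pow_mul_sub_one (by norm_num : Nat.Prime 5) (by norm_num) (by norm_num) (by norm_num)
      ⟨6 * l * n, by ring⟩, fun i hi => ?_⟩
    rw [if_neg (by norm_num : ¬ ((67 : ℕ) ∣ 30 ∧ ¬ (67 : ℕ) ∣ 1))]
    simp only [show ((67 : ℕ) = 3) = False from eq_false (by decide), show ((67 : ℕ) = 5) = False from eq_false (by decide),
      show ((67 : ℕ) = 7) = False from eq_false (by decide), show ((67 : ℕ) = 11) = False from eq_false (by decide), ite_false]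
    refine WRow.cell_tameslot_of_ends ((67 : ℕ) : ℤ) (30 * l) (67 - 1) 0 (2 * 1) (2 * l) 0 1 ((l - 1) / 2) 1 (by norm_num) (by norm_num)
      (by omega) (by omega) ⟨30, by ring⟩ (by omega) le_rfl ?_ hi hn
    have hP : 30 * l * (2 * 1) / (2 * l) = 30 := Nat.div_eq_of_eq_mul_left (by omega) (by ring)
    have hpA : (((67 : ℕ) : ℤ)) ^ 0 = 1 := by norm_num
    rintro i (rfl | hi')
    · rw [hP, hpA]; push_cast; omega
    · obtain ⟨k, hk⟩ := hl.odd_of_ne_two (by omega)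
      have hl' : l = 2 * i + 3 := by omega
      subst hl'
      have hi0 : ((829 : ℕ) : ℤ) ≤ (i : ℤ) := by exact_mod_cast (show 829 ≤ i by omega)
      rw [hP, hpA]; push_cast at hi0 ⊢
      nlinarith [sq_nonneg (i : ℤ), mul_nonneg (sub_nonneg.mpr hi0) (show (0 : ℤ) ≤ (i : ℤ) by positivity)]
  · -- `p = 1019` (`≠ l` since `l ≥ 1663`): `v = 1`, `e = 15·l·n`, `A = 0`
    rw [WRow.factorization_frey37569208117.2.2.2.2.2.2.1] at h15 hodd ⊢
    have he0 : 15 * l ∣ e := by simpa using h15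
    obtain ⟨n, rfl⟩ := he0
    have hn : 1 ≤ n := Nat.pos_of_ne_zero (by rintro rfl; simp at he)
    refine ⟨WRow.natCast_ne_pow_mul_sub_one (by norm_num : Nat.Prime 5) (by norm_num) (by norm_num) (by norm_num)
      ⟨3 * l * n, by ring⟩, fun i hi => ?_⟩
    rw [if_neg (by norm_num : ¬ ((1019 : ℕ) ∣ 30 ∧ ¬ (1019 : ℕ) ∣ 1))]
    simp only [show ((1019 : ℕ) = 3) = False from eq_false (by decide), show ((1019 : ℕ) = 5) = False from eq_false (by decide),
      show ((1019 : ℕ) = 7) = False from eq_false (by decide), show ((1019 : ℕ) = 11) = False from eq_false (by decide), ite_false]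
    refine WRow.cell_tameslot_of_ends ((1019 : ℕ) : ℤ) (15 * l) (1019 - 1) 0 (2 * 1) (2 * l) 0 1 ((l - 1) / 2) 1 (by norm_num) (by norm_num)
      (by omega) (by omega) ⟨15, by ring⟩ (by omega) le_rfl ?_ hi hn
    have hP : 15 * l * (2 * 1) / (2 * l) = 15 := Nat.div_eq_of_eq_mul_left (by omega) (by ring)
    have hpA : (((1019 : ℕ) : ℤ)) ^ 0 = 1 := by norm_num
    rintro i (rfl | hi')
    · rw [hP, hpA]; push_cast; omega
    · obtain ⟨k, hk⟩ := hl.odd_of_ne_two (by omega)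
      have hl' : l = 2 * i + 3 := by omega
      subst hl'
      have hi0 : ((829 : ℕ) : ℤ) ≤ (i : ℤ) := by exact_mod_cast (show 829 ≤ i by omega)
      rw [hP, hpA]; push_cast at hi0 ⊢
      nlinarith [sq_nonneg (i : ℤ), mul_nonneg (sub_nonneg.mpr hi0) (show (0 : ℤ) ≤ (i : ℤ) by positivity)]
  · -- `p = 7151`: `v = 2`, `e = 15·l·n`, `A = 0`
    rw [WRow.factorization_frey37569208117.2.2.2.2.2.2.2] at h15 hodd ⊢
    have he0 : 15 * l ∣ e := (Nat.Coprime.mul_left (by norm_num) hl2 : Nat.Coprime (15 * l) 2).dvd_of_dvd_mul_right h15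
    obtain ⟨n, rfl⟩ := he0
    have hn : 1 ≤ n := Nat.pos_of_ne_zero (by rintro rfl; simp at he)
    refine ⟨WRow.natCast_ne_pow_mul_sub_one (by norm_num : Nat.Prime 3) (by norm_num) (by norm_num) (by norm_num)
      ⟨5 * l * n, by ring⟩, fun i hi => ?_⟩
    rw [if_neg (by norm_num : ¬ ((7151 : ℕ) ∣ 30 ∧ ¬ (7151 : ℕ) ∣ 2))]
    simp only [show ((7151 : ℕ) = 3) = False from eq_false (by decide), show ((7151 : ℕ) = 5) = False from eq_false (by decide),
      show ((7151 : ℕ) = 7) = False from eq_false (by decide), show ((7151 : ℕ) = 11) = False from eq_false (by decide), ite_false]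
    refine WRow.cell_tameslot_of_ends ((7151 : ℕ) : ℤ) (15 * l) (7151 - 1) 0 (2 * 2) (2 * l) 0 1 ((l - 1) / 2) 1 (by norm_num) (by norm_num)
      (by omega) (by omega) ⟨30, by ring⟩ (by omega) le_rfl ?_ hi hn
    have hP : 15 * l * (2 * 2) / (2 * l) = 30 := Nat.div_eq_of_eq_mul_left (by omega) (by ring)
    have hpA : (((7151 : ℕ) : ℤ)) ^ 0 = 1 := by norm_num
    rintro i (rfl | hi')
    · rw [hP, hpA]; push_cast; omega
    · obtain ⟨k, hk⟩ := hl.odd_of_ne_two (by omega)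
      have hl' : l = 2 * i + 3 := by omega
      subst hl'
      have hi0 : ((829 : ℕ) : ℤ) ≤ (i : ℤ) := by exact_mod_cast (show 829 ≤ i by omega)
      rw [hP, hpA]; push_cast at hi0 ⊢
      nlinarith [sq_nonneg (i : ℤ), mul_nonneg (sub_nonneg.mpr hi0) (show (0 : ℤ) ≤ (i : ℤ) by positivity)]

end Summit.ABC.IUTFork.Conditional

end
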